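import Summits.QuantumAdvantage.QuantumAdvantage.Theorems.SosSandwichPseudoBoundedTopPairingRung
import HarnessLib

/-!
# Crux `PseudoBoundedAA` (stmt-QuantumAdvantage-15237) / item `HomogeneousPBAAT` (stmt-27399): the UNIFORM
# CONTRACTION BOUND on `K_T` forces TOP-LEVEL AA for ALL bounded polynomials (calibration of a proposed line)

`Theorems/SosSandwichPseudoBoundedTopPairingRung.lean` reduces the repaired homogeneous rung `HomogeneousPBAAT` (re-typing
of the dead stub `stub_homogeneousRung` of `Cruxes/PseudoBoundedAA/Lines/birth.lean`) — with `stub_levelDescent`, the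
crux — to ONE inline hypothesis, the UNIFORM CONTRACTION BOUND: for every SOS datum `(q_j)` (degrees `≤ T`,
`Σ_j q_j² ≤ 1` on the cube) and ALL weights `c` on the `2T`-sets, `(∀ k, Σ_{|U|=2T, U∋k} c_U² ≤ M) ⟹
Σ_j Σ_{|R|=T} (Σ_{U ⊇ R} c_U q̂_j(U ∖ R))² ≤ K(T)·M` (`K = 1` on `Q_T`, `K ≥ T/4` on the address family).

THIS FILE computes what that hypothesis costs.  For ANY `g` of degree `≤ T` with `g² ≤ 1` on the cube and a set `X`
of IDLE variables of `g` (`|X| ≥ T`), feed the bound the datum `q = g` and the weights `c_U = ĝ(U ∖ X)·[|U ∩ X| = T]`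
(`U = R ⊔ S`, `R ⊆ X` an idle `T`-set, `S` a live `T`-set).  With `W = Σ_{|S|=T} ĝ(S)²`, `μ = max_k Σ_{|S|=T,S∋k} ĝ(S)²`
(§2): idle mass `≤ C(|X|−1,T−1)·W`, live mass `≤ C(|X|,T)·μ`, creation functional `= W` at the `C(|X|,T)` idle
`T`-sets; so for `|X| ≥ T·W/μ` the bound reads `C(|X|,T)·W² ≤ K(T)·C(|X|,T)·μ`:

  **`(W^{=T}[g])² ≤ K(T)·max_k Σ_{S∋k, |S|=T} ĝ(S)²  (≤ K(T)·max_k Inf_k[g]/4)`**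
  (`topWeight_sq_le_of_contraction_of_idle`, `topWeight_sq_le_rowWeight_of_uniformContraction`),

i.e. TOP-LEVEL AARONSON–AMBAINIS with constant `K(T)` for EVERY cube-bounded polynomial of degree `≤ T` — not only
on `K_T`, not only top-homogeneous.  For HOMOGENEOUS bounded `g` (`Var = W^{=T}`) — in particular block-multilinear
(fully decoupled) forms — this is the AA conjecture on that class (`maxInf ≥ 4Var²/K(T)`), an OPEN case of
`AAConjecture` (known only under complete boundedness: Bansal–Sinha–de Wolf arXiv:2203.00212, Escudero Gutiérrez
Thm 1.6) which ALREADY implies AA14's Quantum Conjecture (`QuantumQuerySimulable`) by Aaronson–Ambainis 2015 as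
recorded in O'Donnell–Zhao (arXiv:1512.01603) Remark 2.14 (their Thm 2.13 is the different equivalence AA ⟺ AA for
ONE-block decoupled `f`).  The crux `PseudoBoundedAA` is a CONSEQUENCE of `AAConjecture` (`AAConjImpliesPBAA`).
VERDICT for the planner: a polynomial uniform contraction constant is at least block-multilinear-AA-hard (open) and
would give the route's analytic goal directly, bypassing PB-AA — no shortcut for 15237/27399; a viable contraction
line must use what the idle-variable datum `q = g` lacks: the SECOND certificate `1 − p = Σ r_j²` (sandwich
antisymmetry `TopPairing.cubeFourierCoeff_top_eq_neg_pairing`) and/or the specific weights `c_U = p̂(U)`.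

§1 block split and counts; §2 masses and creation functional; §3 the theorems (padded form: companion file
`…ContractionPadded`).  Honest label: calibration of a proposed line (hypothesis ⟹ consequence); proves neither
27399 nor the crux; no registered stub is closed.  Finite sums only, no named facts.
Sources: EscuderoGutierrez2023 (arXiv:2304.06713) Thm 1.6 / Qu. 4.5; AaronsonAmbainis2014 Conj. 6; ODonnellZhao2016
(arXiv:1512.01603) Thm 2.13 / Rem. 2.14; BansalSinhaDeWolf2022 (arXiv:2203.00212); ODonnell2014 §1.4, §2.2.
-/
set_option linter.dupNamespace false

noncomputable section

namespace Summit.QuantumAdvantage.QuantumAdvantage.Theorems.SosSandwich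

open Finset MvPolynomial Literature.Computability.QuantumComplexity
open Literature.Computability.Complexity.LowDegree Literature.Probability.RandomGraphs.LowDegree

namespace TopPairing

variable {N : ℕ}

/-! ### §1 The block split of the `2T`-sets along a set `X` of idle variables -/

/-- A subset of `Xᶜ` is disjoint from `X`. [folklore] -/
theorem disjoint_of_subset_univ_sdiff (X : Finset (Fin N)) {S : Finset (Fin N)} (hS : S ⊆ Finset.univ \ X) :
    Disjoint S X :=
  Finset.disjoint_left.mpr fun _i hiS hiX => (Finset.mem_sdiff.mp (hS hiS)).2 hiX

/-- For `R ⊆ X` and `S ⊆ Xᶜ`: `(R ∪ S) ∖ X = S`. [folklore] -/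
theorem union_sdiff_eq_right (X : Finset (Fin N)) {R S : Finset (Fin N)} (hR : R ⊆ X)
    (hS : S ⊆ Finset.univ \ X) : (R ∪ S) \ X = S := by
  rw [Finset.union_sdiff_distrib, Finset.sdiff_eq_empty_iff_subset.mpr hR, Finset.empty_union,
    Finset.sdiff_eq_self_iff_disjoint.mpr (disjoint_of_subset_univ_sdiff X hS)]

/-- For `R ⊆ X` and `S ⊆ Xᶜ`: `(R ∪ S) ∩ X = R`. [folklore] -/
theorem union_inter_eq_left (X : Finset (Fin N)) {R S : Finset (Fin N)} (hR : R ⊆ X)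
    (hS : S ⊆ Finset.univ \ X) : (R ∪ S) ∩ X = R := by
  rw [Finset.union_inter_distrib_right, Finset.inter_eq_left.mpr hR,
    Finset.disjoint_iff_inter_eq_empty.mp (disjoint_of_subset_univ_sdiff X hS), Finset.union_empty]

/-- **Block split.**  Summing `Φ` over the `2T`-subsets `U` with exactly `T` elements in `X` is summing
`Φ (R ∪ S)` over the pairs (`T`-subset `R ⊆ X`, `T`-subset `S ⊆ Xᶜ`): `U ↦ (U ∩ X, U ∖ X)` is a bijection.
[folklore] -/
theorem sum_blockSplit (X : Finset (Fin N)) (T : ℕ) (Φ : Finset (Fin N) → ℝ) :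
    ∑ U ∈ Finset.univ.filter (fun U : Finset (Fin N) => U.card = 2 * T),
        (if (U ∩ X).card = T then Φ U else 0) =
      ∑ R ∈ X.powersetCard T, ∑ S ∈ (Finset.univ \ X).powersetCard T, Φ (R ∪ S) := by
  classical
  rw [← Finset.sum_filter, ← Finset.sum_product']
  refine Finset.sum_nbij' (fun U => (U ∩ X, U \ X)) (fun RS => RS.1 ∪ RS.2) ?_ ?_ ?_ ?_ ?_
  · intro U hU
    simp only [Finset.mem_filter, Finset.mem_univ, true_and] at hU
    rw [Finset.mem_product, Finset.mem_powersetCard, Finset.mem_powersetCard]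
    refine ⟨⟨Finset.inter_subset_right, hU.2⟩, ⟨Finset.sdiff_subset_sdiff (Finset.subset_univ U) le_rfl, ?_⟩⟩
    show (U \ X).card = T
    have h := Finset.card_sdiff_add_card_inter U X
    omega
  · rintro ⟨R, S⟩ hRS
    simp only [Finset.mem_product, Finset.mem_powersetCard] at hRS
    obtain ⟨⟨hRX, hRT⟩, ⟨hSX, hST⟩⟩ := hRS
    show R ∪ S ∈ (Finset.univ.filter (fun U : Finset (Fin N) => U.card = 2 * T)).filter
      (fun U => (U ∩ X).card = T)
    simp only [Finset.mem_filter, Finset.mem_univ, true_and]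
    refine ⟨?_, by rw [union_inter_eq_left X hRX hSX]; exact hRT⟩
    rw [Finset.card_union_of_disjoint ((disjoint_of_subset_univ_sdiff X hSX).symm.mono_left hRX)]
    omega
  · intro U _
    show U ∩ X ∪ U \ X = U
    rw [Finset.union_comm, Finset.sdiff_union_inter]
  · rintro ⟨R, S⟩ hRS
    simp only [Finset.mem_product, Finset.mem_powersetCard] at hRS
    show ((R ∪ S) ∩ X, (R ∪ S) \ X) = (R, S)
    rw [union_inter_eq_left X hRS.1.1 hRS.2.1, union_sdiff_eq_right X hRS.1.1 hRS.2.1]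
  · intro U _
    show Φ U = Φ (U ∩ X ∪ U \ X)
    rw [Finset.union_comm, Finset.sdiff_union_inter]

/-- The `T`-subsets of `X` through a fixed `k ∈ X` number at most `C(|X|−1, T−1)` (`R ↦ R.erase k` is injective
into the `(T−1)`-subsets of `X.erase k`). [folklore] -/
theorem card_filter_mem_powersetCard_le (X : Finset (Fin N)) (T : ℕ) {k : Fin N} (hk : k ∈ X) :
    ((X.powersetCard T).filter (fun R => k ∈ R)).card ≤ Nat.choose (X.card - 1) (T - 1) := by
  classical
  rw [← Finset.card_erase_of_mem hk, ← Finset.card_powersetCard (T - 1) (X.erase k)]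
  refine Finset.card_le_card_of_injOn (fun R => R.erase k) ?_ ?_
  · intro R hR
    rw [Finset.coe_filter, Set.mem_setOf_eq, Finset.mem_powersetCard] at hR
    obtain ⟨⟨hRX, hRT⟩, hkR⟩ := hR
    rw [Finset.mem_coe, Finset.mem_powersetCard]
    exact ⟨Finset.erase_subset_erase k hRX, by rw [Finset.card_erase_of_mem hkR, hRT]⟩
  · intro R hR R' hR' h
    rw [Finset.coe_filter, Set.mem_setOf_eq] at hR hR'
    have h' : R.erase k = R'.erase k := h
    rw [← Finset.insert_erase hR.2, ← Finset.insert_erase hR'.2, h']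

/-- `|X| · C(|X|−1, T−1) = T · C(|X|, T)` for `T ≥ 1`, `|X| ≥ 1` (in `ℝ`). [folklore] -/
theorem card_mul_choose_pred (n T : ℕ) (hT : 1 ≤ T) (hn : 1 ≤ n) :
    (n : ℝ) * (Nat.choose (n - 1) (T - 1) : ℝ) = (T : ℝ) * (Nat.choose n T : ℝ) := by
  obtain ⟨a, rfl⟩ : ∃ a, n = a + 1 := ⟨n - 1, by omega⟩
  obtain ⟨b, rfl⟩ : ∃ b, T = b + 1 := ⟨T - 1, by omega⟩
  simp only [Nat.add_sub_cancel]
  have h' : ((a + 1 : ℕ) : ℝ) * (Nat.choose a b : ℝ) = (Nat.choose (a + 1) (b + 1) : ℝ) * ((b + 1 : ℕ) : ℝ) := by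
    exact_mod_cast Nat.add_one_mul_choose_eq a b
  rw [h']
  ring

/-! ### §2 The idle-variable datum: masses and the creation functional -/

section Datum

variable (X : Finset (Fin N)) (T : ℕ) (a : Finset (Fin N) → ℝ)

/-- **The `c`-mass of a variable**, split into blocks: with `c_U = a(U ∖ X)·[|U ∩ X| = T]`,
`Σ_{|U|=2T, U ∋ k} c_U² = Σ_{R ⊆ X, |R|=T} Σ_{S ⊆ Xᶜ, |S|=T} [k ∈ R ∪ S]·a(S)²`. [folklore] -/
theorem rowMass_eq (k : Fin N) :
    ∑ U ∈ Finset.univ.filter (fun U : Finset (Fin N) => U.card = 2 * T ∧ k ∈ U),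
        (if (U ∩ X).card = T then a (U \ X) else 0) ^ 2 =
      ∑ R ∈ X.powersetCard T, ∑ S ∈ (Finset.univ \ X).powersetCard T,
        (if k ∈ R ∪ S then a S ^ 2 else 0) := by
  classical
  have hfilter : Finset.univ.filter (fun U : Finset (Fin N) => U.card = 2 * T ∧ k ∈ U) =
      (Finset.univ.filter (fun U : Finset (Fin N) => U.card = 2 * T)).filter (fun U => k ∈ U) := by
    rw [Finset.filter_filter]
  rw [hfilter, Finset.sum_filter]
  have hterm : ∀ U : Finset (Fin N), (if k ∈ U then (if (U ∩ X).card = T then a (U \ X) else 0) ^ 2 else 0) =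
      (if (U ∩ X).card = T then (if k ∈ U then a (U \ X) ^ 2 else 0) else 0) := by
    intro U
    by_cases h1 : k ∈ U <;> by_cases h2 : (U ∩ X).card = T <;> simp [h1, h2]
  simp_rw [hterm]
  rw [sum_blockSplit X T (fun U => if k ∈ U then a (U \ X) ^ 2 else 0)]
  refine Finset.sum_congr rfl fun R hR => Finset.sum_congr rfl fun S hS => ?_
  rw [Finset.mem_powersetCard] at hR hS
  rw [union_sdiff_eq_right X hR.1 hS.1]

/-- **Idle mass**: for `k ∈ X` the `c`-mass is `#{R ∋ k}·Σ_{S} a(S)² ≤ C(|X|−1,T−1)·Σ_{S ⊆ Xᶜ,|S|=T} a(S)²`.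
[folklore] -/
theorem rowMass_idle_le {k : Fin N} (hk : k ∈ X) :
    ∑ U ∈ Finset.univ.filter (fun U : Finset (Fin N) => U.card = 2 * T ∧ k ∈ U),
        (if (U ∩ X).card = T then a (U \ X) else 0) ^ 2 ≤
      (Nat.choose (X.card - 1) (T - 1) : ℝ) * ∑ S ∈ (Finset.univ \ X).powersetCard T, a S ^ 2 := by
  classical
  rw [rowMass_eq X T a k]
  have hW : 0 ≤ ∑ S ∈ (Finset.univ \ X).powersetCard T, a S ^ 2 :=
    Finset.sum_nonneg fun S _ => sq_nonneg _
  -- for `k ∈ X` and `S ⊆ Xᶜ`: `k ∈ R ∪ S ↔ k ∈ R`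
  have hinner : ∀ R ∈ X.powersetCard T,
      ∑ S ∈ (Finset.univ \ X).powersetCard T, (if k ∈ R ∪ S then a S ^ 2 else 0) =
        if k ∈ R then ∑ S ∈ (Finset.univ \ X).powersetCard T, a S ^ 2 else 0 := by
    intro R _
    by_cases hkR : k ∈ R
    · rw [if_pos hkR]
      refine Finset.sum_congr rfl fun S _ => ?_
      rw [if_pos (Finset.mem_union_left S hkR)]
    · rw [if_neg hkR]
      refine Finset.sum_eq_zero fun S hS => ?_
      rw [Finset.mem_powersetCard] at hS
      have hkS : k ∉ S := fun hkS => (Finset.mem_sdiff.mp (hS.1 hkS)).2 hk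
      rw [if_neg (by rw [Finset.mem_union, not_or]; exact ⟨hkR, hkS⟩)]
  rw [Finset.sum_congr rfl hinner, ← Finset.sum_filter, Finset.sum_const, nsmul_eq_mul]
  exact mul_le_mul_of_nonneg_right (by exact_mod_cast card_filter_mem_powersetCard_le X T hk) hW

/-- **Live mass**: for `k ∉ X` the `c`-mass is `C(|X|,T)·Σ_{S ⊆ Xᶜ, |S|=T, S ∋ k} a(S)² ≤ C(|X|,T)·Σ_{|S|=T, S ∋ k} a(S)²`.
[folklore] -/
theorem rowMass_live_le {k : Fin N} (hk : k ∉ X) :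
    ∑ U ∈ Finset.univ.filter (fun U : Finset (Fin N) => U.card = 2 * T ∧ k ∈ U),
        (if (U ∩ X).card = T then a (U \ X) else 0) ^ 2 ≤
      (Nat.choose X.card T : ℝ) *
        ∑ S ∈ Finset.univ.filter (fun S : Finset (Fin N) => S.card = T ∧ k ∈ S), a S ^ 2 := by
  classical
  rw [rowMass_eq X T a k]
  -- for `k ∉ X` and `R ⊆ X`: `k ∈ R ∪ S ↔ k ∈ S`
  have hinner : ∀ R ∈ X.powersetCard T,
      ∑ S ∈ (Finset.univ \ X).powersetCard T, (if k ∈ R ∪ S then a S ^ 2 else 0) =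
        ∑ S ∈ (Finset.univ \ X).powersetCard T, (if k ∈ S then a S ^ 2 else 0) := by
    intro R hR
    rw [Finset.mem_powersetCard] at hR
    have hkR : k ∉ R := fun h => hk (hR.1 h)
    refine Finset.sum_congr rfl fun S _ => ?_
    simp [Finset.mem_union, hkR]
  rw [Finset.sum_congr rfl hinner, Finset.sum_const, nsmul_eq_mul, Finset.card_powersetCard]
  refine mul_le_mul_of_nonneg_left ?_ (by positivity)
  rw [← Finset.sum_filter]
  refine Finset.sum_le_sum_of_subset_of_nonneg ?_ fun S _ _ => sq_nonneg _
  intro S hS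
  rw [Finset.mem_filter, Finset.mem_powersetCard] at hS
  rw [Finset.mem_filter]
  exact ⟨Finset.mem_univ _, hS.1.2, hS.2⟩

/-- **The creation functional at an idle `T`-set** `R₀ ⊆ X`: with `c_U = a(U ∖ X)·[|U ∩ X| = T]` and a
coefficient family `b` that agrees with `a` off `X` (`b S = a S` for `S ⊆ Xᶜ`),
`Σ_{U ⊇ R₀, |U|=2T} c_U · b(U ∖ R₀) = Σ_{S ⊆ Xᶜ, |S|=T} a(S)²`. [folklore] -/
theorem creation_idle (b : Finset (Fin N) → ℝ) (hab : ∀ S, S ⊆ Finset.univ \ X → b S = a S)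
    {R₀ : Finset (Fin N)} (hR₀ : R₀ ∈ X.powersetCard T) :
    ∑ U ∈ Finset.univ.filter (fun U : Finset (Fin N) => U.card = 2 * T ∧ R₀ ⊆ U),
        (if (U ∩ X).card = T then a (U \ X) else 0) * b (U \ R₀) =
      ∑ S ∈ (Finset.univ \ X).powersetCard T, a S ^ 2 := by
  classical
  have hfilter : Finset.univ.filter (fun U : Finset (Fin N) => U.card = 2 * T ∧ R₀ ⊆ U) =
      (Finset.univ.filter (fun U : Finset (Fin N) => U.card = 2 * T)).filter (fun U => R₀ ⊆ U) := by
    rw [Finset.filter_filter]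
  rw [hfilter, Finset.sum_filter]
  have hterm : ∀ U : Finset (Fin N),
      (if R₀ ⊆ U then (if (U ∩ X).card = T then a (U \ X) else 0) * b (U \ R₀) else 0) =
      (if (U ∩ X).card = T then (if R₀ ⊆ U then a (U \ X) * b (U \ R₀) else 0) else 0) := by
    intro U
    by_cases h1 : R₀ ⊆ U <;> by_cases h2 : (U ∩ X).card = T <;> simp [h1, h2]
  simp_rw [hterm]
  rw [sum_blockSplit X T (fun U => if R₀ ⊆ U then a (U \ X) * b (U \ R₀) else 0)]
  rw [Finset.mem_powersetCard] at hR₀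
  -- only the block `R = R₀` contributes
  have hinner : ∀ R ∈ X.powersetCard T,
      ∑ S ∈ (Finset.univ \ X).powersetCard T,
          (if R₀ ⊆ R ∪ S then a ((R ∪ S) \ X) * b ((R ∪ S) \ R₀) else 0) =
        if R = R₀ then ∑ S ∈ (Finset.univ \ X).powersetCard T, a S ^ 2 else 0 := by
    intro R hR
    rw [Finset.mem_powersetCard] at hR
    by_cases hRR : R = R₀
    · rw [if_pos hRR]
      subst hRR
      refine Finset.sum_congr rfl fun S hS => ?_
      rw [Finset.mem_powersetCard] at hS
      rw [if_pos Finset.subset_union_left, union_sdiff_eq_right X hR.1 hS.1]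
      have hRS : (R ∪ S) \ R = S := by
        rw [Finset.union_sdiff_left, Finset.sdiff_eq_self_iff_disjoint]
        exact (disjoint_of_subset_univ_sdiff X hS.1).mono_right hR.1
      rw [hRS, hab S hS.1, sq]
    · rw [if_neg hRR]
      refine Finset.sum_eq_zero fun S hS => ?_
      rw [Finset.mem_powersetCard] at hS
      rw [if_neg]
      intro hsub
      -- `R₀ ⊆ R ∪ S` with `S ∩ X = ∅` forces `R₀ ⊆ R`, hence `R₀ = R` (equal cards)
      have hR₀R : R₀ ⊆ R := by
        intro i hi
        rcases Finset.mem_union.mp (hsub hi) with h | h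
        · exact h
        · exact absurd (hR₀.1 hi) (Finset.mem_sdiff.mp (hS.1 h)).2
      exact hRR (Finset.eq_of_subset_of_card_le hR₀R (by rw [hR.2, hR₀.2])).symm
  rw [Finset.sum_congr rfl hinner, Finset.sum_ite_eq', if_pos (Finset.mem_powersetCard.mpr hR₀)]

end Datum

/-! ### §3 The uniform contraction bound forces top-level AA for every bounded polynomial -/

/-- **Top-level AA from the contraction estimate (intrinsic form).**  Let `X` be a set of idle variables of `g`
(`T ≥ 1`, `|X| ≥ T`, `T·W ≤ |X|·μ`; `W = Σ_{|S|=T} ĝ(S)²` the top Walsh weight, `μ ≥` every top-level row weight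
`Σ_{|S|=T, S∋k} ĝ(S)²`).  If the datum `q = g` obeys the contraction estimate of `topWeight_sq_le_of_contraction`
with constant `K`, then `W² ≤ K·μ` (weights `c_U = ĝ(U ∖ X)·[|U ∩ X| = T]`; §2: masses `≤ C(|X|,T)·μ`,
`Σ_R Γ(R)² ≥ C(|X|,T)·W²`). [cite: EscuderoGutierrez2023, Thm 1.6 (proof), Question 4.5] -/
theorem topWeight_sq_le_of_contraction_of_idle {T : ℕ} (hT : 1 ≤ T) (K : ℝ)
    (g : MvPolynomial (Fin N) ℝ)
    (hK : ∀ (c : Finset (Fin N) → ℝ) (M : ℝ),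
      (∀ k : Fin N, ∑ U ∈ Finset.univ.filter (fun U : Finset (Fin N) => U.card = 2 * T ∧ k ∈ U),
          c U ^ 2 ≤ M) →
      ∑ R ∈ Finset.univ.filter (fun R : Finset (Fin N) => R.card = T),
        (∑ U ∈ Finset.univ.filter (fun U : Finset (Fin N) => U.card = 2 * T ∧ R ⊆ U),
          c U * cubeFourierCoeff (evalBool g) (U \ R)) ^ 2 ≤ K * M)
    (X : Finset (Fin N)) (hX : ∀ k ∈ X, ∀ x, evalBool g (flipBit k x) = evalBool g x) (hXT : T ≤ X.card)
    (μ : ℝ)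
    (hμ : ∀ k : Fin N, ∑ S ∈ Finset.univ.filter (fun S : Finset (Fin N) => S.card = T ∧ k ∈ S),
      cubeFourierCoeff (evalBool g) S ^ 2 ≤ μ)
    (hlarge : (T : ℝ) * ∑ S ∈ Finset.univ.filter (fun S : Finset (Fin N) => S.card = T),
      cubeFourierCoeff (evalBool g) S ^ 2 ≤ X.card * μ) :
    (∑ S ∈ Finset.univ.filter (fun S : Finset (Fin N) => S.card = T),
        cubeFourierCoeff (evalBool g) S ^ 2) ^ 2 ≤ K * μ := by
  classical
  set a : Finset (Fin N) → ℝ := fun S => cubeFourierCoeff (evalBool g) S with ha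
  set W := ∑ S ∈ Finset.univ.filter (fun S : Finset (Fin N) => S.card = T), a S ^ 2 with hWdef
  -- `W' = W`: top coefficients of sets meeting `X` vanish
  have hWW : ∑ S ∈ (Finset.univ \ X).powersetCard T, a S ^ 2 = W := by
    rw [hWdef]
    refine Finset.sum_subset
      (fun S hS => Finset.mem_filter.mpr ⟨Finset.mem_univ _, (Finset.mem_powersetCard.mp hS).2⟩) ?_
    intro S hS hS'
    have h : ¬ S ⊆ Finset.univ \ X := fun h =>
      hS' (Finset.mem_powersetCard.mpr ⟨h, (Finset.mem_filter.mp hS).2⟩)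
    obtain ⟨k, hkS, hkX⟩ : ∃ k ∈ S, k ∈ X := by
      by_contra hcon
      push Not at hcon
      exact h fun i hi => Finset.mem_sdiff.mpr ⟨Finset.mem_univ _, hcon i hi⟩
    show cubeFourierCoeff (evalBool g) S ^ 2 = 0
    rw [cubeFourierCoeff_eq_zero_of_flipBit (hX k hkX) hkS, sq, mul_zero]
  have hXpos : 0 < X.card := lt_of_lt_of_le (by omega) hXT
  have hchoose_pos : (0 : ℝ) < (Nat.choose X.card T : ℝ) := by exact_mod_cast Nat.choose_pos hXT
  -- the weights and the mass bound
  set c : Finset (Fin N) → ℝ := fun U => if (U ∩ X).card = T then a (U \ X) else 0 with hc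
  set M : ℝ := (Nat.choose X.card T : ℝ) * μ with hM
  have hmass : ∀ k : Fin N,
      ∑ U ∈ Finset.univ.filter (fun U : Finset (Fin N) => U.card = 2 * T ∧ k ∈ U), c U ^ 2 ≤ M := by
    intro k
    by_cases hk : k ∈ X
    · refine (rowMass_idle_le X T a hk).trans ?_
      rw [hWW, hM]
      -- `C(|X|−1,T−1)·W ≤ C(|X|,T)·μ` from `T·W ≤ |X|·μ` and `|X|·C(|X|−1,T−1) = T·C(|X|,T)`
      have hid := card_mul_choose_pred X.card T hT hXpos
      have hXr : (0 : ℝ) < X.card := by exact_mod_cast hXpos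
      have key : (X.card : ℝ) * ((Nat.choose (X.card - 1) (T - 1) : ℝ) * W) ≤
          (X.card : ℝ) * ((Nat.choose X.card T : ℝ) * μ) := by
        calc (X.card : ℝ) * ((Nat.choose (X.card - 1) (T - 1) : ℝ) * W)
            = (Nat.choose X.card T : ℝ) * ((T : ℝ) * W) := by rw [← mul_assoc, hid]; ring
          _ ≤ (Nat.choose X.card T : ℝ) * ((X.card : ℝ) * μ) :=
              mul_le_mul_of_nonneg_left hlarge hchoose_pos.le
          _ = (X.card : ℝ) * ((Nat.choose X.card T : ℝ) * μ) := by ring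
      exact le_of_mul_le_mul_left key hXr
    · exact (rowMass_live_le X T a hk).trans (mul_le_mul_of_nonneg_left (hμ k) hchoose_pos.le)
  -- the contraction estimate for these weights
  have hcon := hK c M hmass
  -- lower bound: the idle `T`-sets each contribute `W²`
  have hlow : (Nat.choose X.card T : ℝ) * W ^ 2 ≤
      ∑ R ∈ Finset.univ.filter (fun R : Finset (Fin N) => R.card = T),
        (∑ U ∈ Finset.univ.filter (fun U : Finset (Fin N) => U.card = 2 * T ∧ R ⊆ U),
          c U * a (U \ R)) ^ 2 := by
    have hsub : X.powersetCard T ⊆ Finset.univ.filter (fun R : Finset (Fin N) => R.card = T) := by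
      intro R hR
      rw [Finset.mem_powersetCard] at hR
      rw [Finset.mem_filter]
      exact ⟨Finset.mem_univ _, hR.2⟩
    refine le_trans ?_ (Finset.sum_le_sum_of_subset_of_nonneg hsub fun R _ _ => sq_nonneg _)
    have hR : ∀ R ∈ X.powersetCard T,
        (∑ U ∈ Finset.univ.filter (fun U : Finset (Fin N) => U.card = 2 * T ∧ R ⊆ U),
          c U * a (U \ R)) ^ 2 = W ^ 2 := by
      intro R hR
      rw [creation_idle X T a a (fun S _ => rfl) hR, hWW]
    rw [Finset.sum_congr rfl hR, Finset.sum_const, nsmul_eq_mul, Finset.card_powersetCard]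
  have hfinal : (Nat.choose X.card T : ℝ) * W ^ 2 ≤ (Nat.choose X.card T : ℝ) * (K * μ) := by
    calc (Nat.choose X.card T : ℝ) * W ^ 2 ≤ K * M := hlow.trans hcon
      _ = (Nat.choose X.card T : ℝ) * (K * μ) := by rw [hM]; ring
  exact le_of_mul_le_mul_left hfinal hchoose_pos

/-- **The UNIFORM contraction bound (hypothesis of `homogeneousPBAAT_of_contractionBound`, constant `K T` at
order `T`) forces TOP-LEVEL AA with constant `K T` for EVERY cube-bounded polynomial with enough idle
variables**: if `g` has total degree `≤ T`, `g² ≤ 1` on the cube, does not depend on the variables in `X`,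
`|X| ≥ T` and `T·W^{=T}[g] ≤ |X|·μ` with `μ ≥ Σ_{|S|=T, S∋k} ĝ(S)²` for all `k`, then `(W^{=T}[g])² ≤ K T · μ`.
(Idle variables change no Walsh coefficient, so this is top-level AA for all bounded `g`; for homogeneous `g`,
`Var = W^{=T}` and it is the Aaronson–Ambainis conjecture on that class — open, and by Aaronson–Ambainis 2015 /
O'Donnell–Zhao Remark 2.14 already sufficient for the Quantum Conjecture.)
[cite: EscuderoGutierrez2023, Question 4.5] [cite: ODonnellZhao2016, Remark 2.14] -/
theorem topWeight_sq_le_rowWeight_of_uniformContraction (K : ℕ → ℝ)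
    (h : ∀ (N T m : ℕ) (q : Fin m → MvPolynomial (Fin N) ℝ) (p : MvPolynomial (Fin N) ℝ), 1 ≤ T →
      (∀ j, (q j).totalDegree ≤ T) → (∀ x, evalBool p x = ∑ j, evalBool (q j) x ^ 2) →
      (∀ x, evalBool p x ≤ 1) →
      ∀ (c : Finset (Fin N) → ℝ) (M : ℝ),
        (∀ k : Fin N, ∑ U ∈ Finset.univ.filter (fun U : Finset (Fin N) => U.card = 2 * T ∧ k ∈ U), c U ^ 2 ≤ M) →
        ∑ j, ∑ R ∈ Finset.univ.filter (fun R : Finset (Fin N) => R.card = T),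
          (∑ U ∈ Finset.univ.filter (fun U : Finset (Fin N) => U.card = 2 * T ∧ R ⊆ U),
            c U * cubeFourierCoeff (evalBool (q j)) (U \ R)) ^ 2 ≤ K T * M)
    {N T : ℕ} (hT : 1 ≤ T) (g : MvPolynomial (Fin N) ℝ) (hg : g.totalDegree ≤ T)
    (hg1 : ∀ x, evalBool g x ^ 2 ≤ 1)
    (X : Finset (Fin N)) (hX : ∀ k ∈ X, ∀ x, evalBool g (flipBit k x) = evalBool g x) (hXT : T ≤ X.card)
    (μ : ℝ)
    (hμ : ∀ k : Fin N, ∑ S ∈ Finset.univ.filter (fun S : Finset (Fin N) => S.card = T ∧ k ∈ S),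
      cubeFourierCoeff (evalBool g) S ^ 2 ≤ μ)
    (hlarge : (T : ℝ) * ∑ S ∈ Finset.univ.filter (fun S : Finset (Fin N) => S.card = T),
      cubeFourierCoeff (evalBool g) S ^ 2 ≤ X.card * μ) :
    (∑ S ∈ Finset.univ.filter (fun S : Finset (Fin N) => S.card = T),
        cubeFourierCoeff (evalBool g) S ^ 2) ^ 2 ≤ K T * μ := by
  refine topWeight_sq_le_of_contraction_of_idle hT (K T) g ?_ X hX hXT μ hμ hlarge
  intro c M hcM
  have hsq : ∀ x, evalBool (g ^ 2) x = ∑ j : Fin 1, evalBool ((fun _ : Fin 1 => g) j) x ^ 2 := fun x => by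
    rw [Fin.sum_univ_one]; unfold evalBool; exact map_pow _ _ _
  have hle : ∀ x, evalBool (g ^ 2) x ≤ 1 := fun x => by rw [hsq x, Fin.sum_univ_one]; exact hg1 x
  simpa only [Fin.sum_univ_one] using h N T 1 (fun _ => g) (g ^ 2) hT (fun _ => hg) hsq hle c M hcM

end TopPairing

end Summit.QuantumAdvantage.QuantumAdvantage.Theorems.SosSandwich

end
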